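import Literature.MathematicalPhysics.QuantumFieldTheory.Balaban1983to89.B9B8KnitBondAvgColumns
import Literature.MathematicalPhysics.QuantumFieldTheory.Balaban1983to89.B13BondAveragingReadingNumerals

/-!
# `Balaban1983to89.B9B8KnitBondAvgSupport` — the (B)-line bond junction, file c2 (part III): THE SUPPORT OF def-Y's AVERAGING KERNEL IN THE KNIT's WINDOW
# COORDINATES — `qK ι f ≠ 0` forces `ι` to be one of the (two) index bonds over the [Balaban1985Averaging] window bonds `winBase L j y μ t` (`t = 0, 1`) of the
# fine bond `f = ⟨0 + y, μ⟩`, an index bond is determined by (level, integer representative of its source, direction), the window bonds contain `y`, and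
# the knit's flat class field ∕ transpose at `U₀ = 1` unfold to `linQIter`

statement-level skeleton of published theorems with citation tags; proofs where landed; nothing here is a claim about the
Yang–Mills mass gap

Sub-row G-B8-T2S (unit `lit-balaban-t2s-1`, gen 7), RULING #10 road, crux (c′) (design `lit-balaban-t2s-1/g7/BLINE-DESIGN-g7.md` §3).  The flat agreement
`Q*(1)aQ(1) = (c_fη)²·(QQZdP(1)·♯)♭` compares a sum over ALL index bonds (def-Y's `QsY`, kernel `qsK = qKᵀ`) with the knit's sum over the `2(d+1)` window bonds
of `B9Eq316AveragingTransposeZd.linCovIterT`.  This file supplies the combinatorial half: the support of `qK(·, f)` ([3] (1.18): the straight contours from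
`B^j(ι₋)`; `exists_run_of_qK_ne_zero`) lies over the two window bonds of direction `μ = f.dir` (`winBase`, [5] p. 24), index bonds are determined by level,
source and direction, the window bonds contain the fine site, and at `U₀ = 1` the knit's class field of the top level is `η·linQIter` while the other levels
and the transpose of a zero field vanish.  Print: [3] (1.18) p. 20; [5] p. 24, (127) p. 37, (147) p. 40; [4] (3.12)–(3.13), (3.16) pp. 392–393; [B8] (1.58) p. 86.

WHAT IS PROVED (kernel, 0 sorry; theorems only, no `def`, no `… : Prop` fact, no `instance`).
* §1 charts: `window_winBase` (`Lʲ·w_ν ≤ y_ν < Lʲ·w_ν + 2Lʲ` for `w = winBase L j y κ t`), `runSite_injective`, ★ `iterBlockOf_transl_zero`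
  (`B^j`-point of `0 + v` is `0 + ⌊v∕Lʲ⌋`), ★ `ibondY_eq_of_key_eq` (index bonds with the same level, the same integer representative `rel 0` of the source
  and the same direction are equal).
* §2 ★★ `dir_eq_of_qK_ne_zero` ∕ ★★ `src_eq_winBase_of_qK_ne_zero` — THE SUPPORT: `qK ι f ≠ 0 ⟹ ι.dir = f.dir` and `ι₋ = 0 + winBase L j(ι) (rel 0 f₋) f.dir t`
  for some `t ∈ {0, 1}`.
* §3 knit side at `U₀ = 1` (`Eᵀ0 = 0` is `B9Eq332AveragingLetterCovarianceZd.entryT_zero'`): `clsField_of_ne` (class field vanishes off the top level of `torusLamb`), ★ `clsField_one_top`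
  (`= η·linQIter A n` on bounded `A`), `linCovIter_one_bump` (the flat column as a function of the bump value).

HONEST SCOPE.  Flat bookkeeping only; the assembled flat agreement and the curved comparison are NOT here; count-neutral; nothing continuum ∕ ℝ⁴ ∕ OS ∕ mass
gap ∕ Clay — the Yang–Mills mass gap is NOT proved here.  NEW file; parts I–II, c1, c2a, r03's support theorem and the charts are used BY NAME.
-/

noncomputable section

namespace Literature.MathematicalPhysics.QuantumFieldTheory.Balaban1983to89.B9B8KnitBondAvgSupport

open scoped BigOperators
open Node00
open B7Prop1Explicit renaming Site → LSite
open B7Prop1Explicit (e e_apply boxVec)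
open B6KLevelCensusIndexV1 (KIdx)
open B6GlobalChartV1 (PV domT)
open B5Eq118OneStroke (iterBlockOf iterBlock mem_iterBlock mem_iterBlock_iff)
open B7Prop4Flat (linQIter linQIter_csmul)
open B7Prop4GeneralLevels (linCovIter)
open B7Prop5Flat (bump norm_bump_le)
open B10Eq27TorusAxialLog (transl transl_apply rel transl_rel)
open B9B8KnitBondTransfer (liftBd liftBd_apply)
open B9B8KnitBondAvgDictionary (sitesPerDir_zero_eq_mul val_transl_boxVec transl_boxVec_mem_iterBlock runSite_transl linCovIter_one_eq_linQIter)
open B9B8KnitBondAvgColumns (transl_zero_eq_iff_of_abs_lt)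
open B9Eq316AveragingTransposeZd (entryT winBase clsField)
open B8Eq146AExpansion (iEta)
open B8Thm2TorusMember (torusLamb mem_torusLamb_iff)
open B13BondAveragingReadingNumerals (exists_run_of_qK_ne_zero)
open LatticeFieldCalculus (runSite runBond)

variable {d ℓ : ℕ} {hd : 1 ≤ d + 1} {hL : Odd (ℓ + 1) ∧ 1 < ℓ + 1} {b₀ b₁ : ℝ}

/-! ## §1 Charts: the window bonds, block points of translates, the key of an index bond -/

section Charts

variable {m K : ℕ}

/-- **THE WINDOW BONDS CONTAIN THE SITE**: for `w = winBase L j y κ t` (`t = 0, 1`), `Lʲw_ν ≤ y_ν < Lʲw_ν + 2Lʲ` in every coordinate.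
[cite: Balaban1985Averaging, p.24 (after (43)), (141) p.39] -/
theorem window_winBase {L : ℕ} (hL : 1 ≤ L) (j : ℕ) (y : LSite (d + 1)) (κ : Fin (d + 1)) (t : Fin 2) (ν : Fin (d + 1)) :
    ((L ^ j : ℕ) : ℤ) * winBase L j y κ t ν ≤ y ν ∧ y ν < ((L ^ j : ℕ) : ℤ) * winBase L j y κ t ν + 2 * ((L ^ j : ℕ) : ℤ) := by
  have hN : (0 : ℤ) < ((L ^ j : ℕ) : ℤ) := by positivity
  have hc : ((L : ℤ)) ^ j = ((L ^ j : ℕ) : ℤ) := by push_cast; ring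
  have h1 := Int.ediv_mul_le (y ν) hN.ne'
  have h2 := Int.lt_ediv_add_one_mul_self (y ν) hN
  have ht : ((t : ℕ) : ℤ) = 0 ∨ ((t : ℕ) : ℤ) = 1 := by have := t.2; omega
  unfold winBase
  rw [hc]
  split_ifs with hνκ
  · rcases ht with h0 | h0 <;> rw [h0] <;> constructor <;> nlinarith
  · constructor <;> nlinarith

/-- `x ↦ x + te_μ` is injective on `T^{(j)}`. [cite: Balaban1984PropagatorsI, (1.7) p.18, bookkeeping] -/
theorem runSite_injective {P : Params} {j : ℕ} (μ : Fin P.d) (t : ℕ) : Function.Injective fun x : Site P j => runSite x μ t := by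
  intro x x' h
  have h' : runSite x μ t = runSite x' μ t := h
  funext ν
  have hν := congrFun h' ν
  unfold runSite at hν
  by_cases hνμ : ν = μ
  · subst hνμ
    rw [Function.update_self, Function.update_self] at hν
    exact add_right_cancel hν
  · rw [Function.update_of_ne hνμ, Function.update_of_ne hνμ] at hν
    exact hν

/-- ★ **THE `B^j`-POINT OF A TRANSLATE**: `iterBlockOf j (0 + v) = 0 + ⌊v∕Lʲ⌋` (coordinatewise Euclidean quotient; `j ≤ m + K`).
[cite: Balaban1984PropagatorsI, (1.6) p.18] -/
theorem iterBlockOf_transl_zero {j : ℕ} (hj : j ≤ m + K) (v : LSite (d + 1)) :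
    iterBlockOf j (transl (0 : Site (PV d ℓ m K hd hL) 0) v) =
      transl (0 : Site (PV d ℓ m K hd hL) j) (fun ν => v ν / (((ℓ + 1) ^ j : ℕ) : ℤ)) := by
  have hN : (0 : ℤ) < (((ℓ + 1) ^ j : ℕ) : ℤ) := by positivity
  set z : LSite (d + 1) := fun ν => v ν / (((ℓ + 1) ^ j : ℕ) : ℤ) with hz
  set r : Fin (d + 1) → Fin ((ℓ + 1) ^ j) := fun ν => ⟨(v ν % (((ℓ + 1) ^ j : ℕ) : ℤ)).toNat, by
    have h1 := Int.emod_lt_of_pos (v ν) hN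
    have h0 := Int.emod_nonneg (v ν) hN.ne'
    omega⟩ with hr
  have hv : v = ((((ℓ + 1) ^ j : ℕ) : ℤ)) • z + boxVec ((ℓ + 1) ^ j) r := by
    funext ν
    simp only [Pi.add_apply, Pi.smul_apply, smul_eq_mul, boxVec, hr, hz]
    have h0 := Int.emod_nonneg (v ν) hN.ne'
    rw [Int.toNat_of_nonneg h0]
    exact (Int.mul_ediv_add_emod (v ν) _).symm
  have hmem := transl_boxVec_mem_iterBlock (d := d) (ℓ := ℓ) (m := m) (K := K) (hd := hd) (hL := hL) hj z r
  rw [← hv] at hmem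
  exact (mem_iterBlock _ _ _).1 hmem

variable (i : KIdx d ℓ hd hL b₀ b₁)

/-- ★ **AN INDEX BOND IS DETERMINED BY ITS LEVEL, THE INTEGER REPRESENTATIVE OF ITS SOURCE AND ITS DIRECTION.**
[cite: Balaban1984PropagatorsII, (2.3)–(2.4) p.224, dictionary (charts)] -/
theorem ibondY_eq_of_key_eq {ι ι' : IBondY i} (h1 : (ι.1.1 : ℕ) = (ι'.1.1 : ℕ))
    (h2 : rel (0 : Site (PV d ℓ i.m i.K hd hL) (ι.1.1 : ℕ)) ι.1.2.src = rel (0 : Site (PV d ℓ i.m i.K hd hL) (ι'.1.1 : ℕ)) ι'.1.2.src)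
    (h3 : ι.1.2.dir = ι'.1.2.dir) : ι = ι' := by
  obtain ⟨⟨j, c⟩, hc⟩ := ι
  obtain ⟨⟨j', c'⟩, hc'⟩ := ι'
  have hjj : j = j' := Fin.ext h1
  subst hjj
  simp only at h2 h3
  have hsrc : c.src = c'.src := by rw [← transl_rel (0 : Site (PV d ℓ i.m i.K hd hL) (j : ℕ)) c.src, h2, transl_rel]
  have hcc : c = c' := by
    cases c; cases c'
    simp only at hsrc h3
    rw [hsrc, h3]
  subst hcc
  rfl

end Charts

/-! ## §2 The support of `qK(·, f)` in window coordinates -/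

section Support

variable (i : KIdx d ℓ hd hL b₀ b₁)

/-- ★★ **DIRECTION**: `qK ι f ≠ 0 ⟹ ι.dir = f.dir` (the contours of `Q` at `ι` run in the direction of `ι`). [cite: Balaban1984PropagatorsI, (1.18) p.20] -/
theorem dir_eq_of_qK_ne_zero {ι : IBondY i} {f : FBondY i} (h : qK i ι f ≠ 0) : ι.1.2.dir = f.dir := by
  obtain ⟨x, -, t, -, hrun⟩ := exists_run_of_qK_ne_zero i h
  exact congrArg PBond.dir hrun

/-- ★★ **SOURCE**: `qK ι f ≠ 0 ⟹ ι₋ = 0 + winBase L j(ι) (rel 0 f₋) f.dir t` for some `t ∈ {0, 1}` — the index bond is one of the two window bonds of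
direction `f.dir` whose double block contains `f₋`. [cite: Balaban1984PropagatorsI, (1.18) p.20; Balaban1985Averaging, p.24 (after (43))] -/
theorem src_eq_winBase_of_qK_ne_zero {ι : IBondY i} {f : FBondY i} (h : qK i ι f ≠ 0) :
    ∃ t : Fin 2, ι.1.2.src = transl (0 : Site (PV d ℓ i.m i.K hd hL) (ι.1.1 : ℕ))
      (winBase (ℓ + 1) (ι.1.1 : ℕ) (rel (0 : Site (PV d ℓ i.m i.K hd hL) 0) f.src) f.dir t) := by
  set j : ℕ := (ι.1.1 : ℕ) with hjdef
  set N : ℕ := (ℓ + 1) ^ j with hNdef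
  set y : LSite (d + 1) := rel (0 : Site (PV d ℓ i.m i.K hd hL) 0) f.src with hydef
  have hj : j ≤ i.m + i.K := B6Ineq2142KLevelV1.lvl_le_mK i.hN i.D i.hk ι
  have hN : (0 : ℤ) < ((N : ℕ) : ℤ) := by positivity
  obtain ⟨x, hx, t', ht', hrun⟩ := exists_run_of_qK_ne_zero i h
  have hdir : ι.1.2.dir = f.dir := congrArg PBond.dir hrun
  rw [hdir] at hrun
  -- `x = 0 + (y − t′e_μ)`
  have hxeq : x = transl (0 : Site (PV d ℓ i.m i.K hd hL) 0) (y - ((t' : ℕ) : ℤ) • e f.dir) := by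
    apply runSite_injective f.dir t'
    have h1 : runSite x f.dir t' = f.src := congrArg PBond.src hrun
    simp only
    rw [h1, runSite_transl, sub_add_cancel, hydef, transl_rel]
  -- the block point of `x`
  have hsrc : ι.1.2.src = iterBlockOf j x := ((mem_iterBlock _ _ _).1 hx).symm
  rw [hxeq, iterBlockOf_transl_zero (hd := hd) (hL := hL) hj] at hsrc
  -- the quotient `(y_μ − t′)∕N ∈ {y_μ∕N − 1, y_μ∕N}`
  have hq1 := Int.ediv_mul_le (y f.dir - ((t' : ℕ) : ℤ)) hN.ne'
  have hq2 := Int.lt_ediv_add_one_mul_self (y f.dir - ((t' : ℕ) : ℤ)) hN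
  have hq3 := Int.ediv_mul_le (y f.dir) hN.ne'
  have hq4 := Int.lt_ediv_add_one_mul_self (y f.dir) hN
  have ht'N : ((t' : ℕ) : ℤ) < ((N : ℕ) : ℤ) := by exact_mod_cast ht'
  have hrange : (y f.dir - ((t' : ℕ) : ℤ)) / ((N : ℕ) : ℤ) = y f.dir / ((N : ℕ) : ℤ) ∨
      (y f.dir - ((t' : ℕ) : ℤ)) / ((N : ℕ) : ℤ) = y f.dir / ((N : ℕ) : ℤ) - 1 := by
    set q := (y f.dir - ((t' : ℕ) : ℤ)) / ((N : ℕ) : ℤ)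
    set q₀ := y f.dir / ((N : ℕ) : ℤ)
    have hle : q ≤ q₀ := by nlinarith
    have hge : q₀ - 1 ≤ q := by nlinarith
    omega
  have hc : ∀ ν, y ν / (((ℓ + 1 : ℕ) : ℤ)) ^ (ι.1.1 : ℕ) = y ν / ((N : ℕ) : ℤ) := fun ν => by
    rw [hNdef, Nat.cast_pow]
  have hcoord : ∀ ν, (y - ((t' : ℕ) : ℤ) • e f.dir) ν = y ν - (if ν = f.dir then ((t' : ℕ) : ℤ) else 0) := fun ν => by
    simp only [Pi.sub_apply, Pi.smul_apply, e_apply, smul_eq_mul]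
    split_ifs <;> ring
  rcases hrange with h0 | h1
  · refine ⟨0, ?_⟩
    rw [hsrc]
    congr 1
    funext ν
    unfold winBase
    rw [hc ν, hcoord ν, hNdef]
    by_cases hν : ν = f.dir
    · subst hν
      rw [if_pos rfl, if_pos rfl, Fin.val_zero, Nat.cast_zero, sub_zero]
      exact h0
    · rw [if_neg hν, if_neg hν, sub_zero, sub_zero]
  · refine ⟨1, ?_⟩
    rw [hsrc]
    congr 1
    funext ν
    unfold winBase
    rw [hc ν, hcoord ν, hNdef]
    by_cases hν : ν = f.dir
    · subst hν
      rw [if_pos rfl, if_pos rfl, Fin.val_one, Nat.cast_one]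
      exact h1
    · rw [if_neg hν, if_neg hν, sub_zero, sub_zero]

end Support

/-! ## §3 The knit's class field and transpose at `U₀ = 1` -/

section KnitFlat

variable {𝔸 : Type} [CStarAlgebra 𝔸] [FiniteDimensional ℝ 𝔸] (τ : 𝔸 →ₗ[ℂ] ℂ)

omit [FiniteDimensional ℝ 𝔸] in
/-- off the top level the class field of `torusLamb n` vanishes. [cite: Balaban1985RegularSpaces, (1.37) p.82 («Λ_j = B_j(Λ_j^{(j)})», empty below the top)] -/
theorem clsField_of_ne {L : ℕ} (η : ℝ) {n j : ℕ} (hj : j ≠ n) (U₀ : LSite (d + 1) → Fin (d + 1) → 𝔸ˣ) (A : LSite (d + 1) → Fin (d + 1) → 𝔸) :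
    clsField L (fun m' => torusLamb (d := d + 1) m') η n j U₀ A = 0 := by
  classical
  funext z κ
  unfold clsField
  rw [if_neg]
  · rfl
  · rw [mem_torusLamb_iff]; exact hj

omit [FiniteDimensional ℝ 𝔸] in
/-- ★ **THE TOP CLASS FIELD AT `U₀ = 1` IS `η·linQIter`**: `𝟙·(−i)·LⁿQ_n(1)(iηA) = η·LⁿQ_n^{flat}A` for bounded `A` (`L ≥ 1`).
[cite: Balaban1985Averaging, (127) p.37; Balaban1985RegularSpaces, (1.58) p.86] -/
theorem clsField_one_top [Nontrivial 𝔸] {L : ℕ} (hL : 1 ≤ L) (η : ℝ) (n : ℕ) {A : LSite (d + 1) → Fin (d + 1) → 𝔸} {b : ℝ} (hb : 0 ≤ b)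
    (hA : ∀ x κ, ‖A x κ‖ ≤ b) (z : LSite (d + 1)) (κ : Fin (d + 1)) :
    clsField L (fun m' => torusLamb (d := d + 1) m') η n n (1 : LSite (d + 1) → Fin (d + 1) → 𝔸ˣ) A z κ = ((η : ℝ) : ℂ) • linQIter L A n z κ := by
  classical
  unfold clsField
  rw [if_pos ((mem_torusLamb_iff _ _ _).2 rfl)]
  have hbd : ∀ x κ', ‖iEta η A x κ'‖ ≤ |η| * b := fun x κ' => by
    unfold iEta
    rw [norm_smul, norm_mul, Complex.norm_I, one_mul, Complex.norm_real, Real.norm_eq_abs]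
    exact mul_le_mul_of_nonneg_left (hA x κ') (abs_nonneg η)
  rw [linCovIter_one_eq_linQIter hL (iEta η A) (by positivity) hbd n]
  have hfun : iEta η A = ((Complex.I : ℂ) * η) • A := by funext x κ'; rfl
  rw [hfun, linQIter_csmul, smul_smul]
  congr 1
  rw [← mul_assoc, neg_mul, Complex.I_mul_I, neg_neg, one_mul]

omit [FiniteDimensional ℝ 𝔸] in
/-- the flat column of the composite averaging as a function of the bump value (`L ≥ 1`): `X ↦ LʲQ_j(1)(bump y μ X)(w, κ) = X ↦ linQIter L (bump y μ X) j w κ`.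
[cite: Balaban1985Averaging, (127) p.37, (147) p.40] -/
theorem linCovIter_one_bump [Nontrivial 𝔸] {L : ℕ} (hL : 1 ≤ L) (y w : LSite (d + 1)) (μ κ : Fin (d + 1)) (j : ℕ) :
    (fun X : 𝔸 => linCovIter L (1 : LSite (d + 1) → Fin (d + 1) → 𝔸ˣ) (bump y μ X) j w κ) = fun X : 𝔸 => linQIter L (bump y μ X) j w κ := by
  funext X
  rw [linCovIter_one_eq_linQIter hL (bump y μ X) (norm_nonneg X) (fun x κ' => norm_bump_le y μ X x κ') j]

end KnitFlat

end Literature.MathematicalPhysics.QuantumFieldTheory.Balaban1983to89.B9B8KnitBondAvgSupport
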